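import Summits.CriticalPhenomena.SAWScalingLimit.Theses.SAWRenewalTightness
import Literature.Probability.Percolation.InterfaceScalingLimitProofs
import Literature.Probability.Percolation.BoxCrossingProofs

/-!
# `TightOfShellCrossing`: the Aizenman–Burchard criterion applied to the critical `ℤ²` SAW

Route `SAWRenewalTightness`, support item `stmt-CriticalPhenomena-4732`:
`ShellCrossingBound → EventualTight`.

Given the shell-crossing bound (Aizenman–Burchard hypothesis (H1) with a shell-dependent
threshold `k x ρ R`, constants `K`, `λ > 2`, for meshes `δ ∈ (0, δ₁]`), eventual tightness of the
pushed-forward critical SAW laws follows from the PROVED tree criterion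
`Literature.Probability.RandomPlanarGeometry.isTightMeasureSet_of_traversalBounds`
(`CurveTightness.lean`, AB99 Thms 1.1–1.2) with

* `Λ = closedBall 0 rΛ`, a disc containing `Ω` and the unit disc about the marked point `a`
  (the latter only matters for the junk nil walk when `a_δ = b_δ ∉ Ω_δ`), covering numbers
  `≤ 9 (rΛ + 2)² ρ⁻²` (`exists_finset_card_le_cover_closedBall`, `d = 2 < λ`);
* `T = Ioc 0 δ₀`, `δ₀ = min (min δ₁ (δ₂ / 2)) 1` where `δ · a_δ ∈ B(a, 1)` for `δ < δ₂`
  (`IsEndpointApprox.tendsto_fst`);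
* `X_δ γ = ⟨γ.walk.toCurve (meshPoint δ)⟩`, the SAW polyline, so that `CurveClass.mk ∘ X_δ` is
  `DomainSAW.curve` definitionally;
* threshold `max (k x ρ R) k₀` and constant `max K 0`: (H1) is `ShellCrossingBound` weakened by
  monotonicity in the threshold (`Curve.HasTraversals.of_le`), and (H0) — no `k₀` separate
  traversals of a shell of inner radius `ρ ≤ δ` by a self-avoiding polyline of step `δ` — is the
  quantitative short-distance cutoff of AB99 §1.a: the times the polyline spends in `B̄(x, ρ)`
  are covered by boundedly many intervals (one per lattice edge near `x`, no edge is repeated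
  along a path: `hasOrdConnectedCover_preimage_polylineFrom`, `segMeetCount_map_le_card` of
  `InterfaceScalingLimitProofs.lean`), and each interval carries at most two separate traversals
  (`le_of_hasTraversals_of_hasOrdConnectedCover`). Here `k₀ = 2 (49² + 1) + 1`: both ends of an
  edge meeting `B̄(x, ρ)`, `ρ ≤ δ`, lie in the `7 × 7` box of sites about the site nearest to `x`.

## References

* M. Aizenman, A. Burchard, *Hölder regularity and dimension bounds for random curves*, Duke
  Math. J. 99 (1999) 419–453, Thms 1.1–1.2, Lemma 3.1, §1.a [AizenmanBurchardDuke1999].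
-/

noncomputable section

open Set Filter Topology Metric MeasureTheory
open scoped unitInterval ENNReal
open Literature.Probability.RandomPlanarGeometry Literature.Probability.LatticeModels

namespace Summit.CriticalPhenomena.SAWScalingLimit.Theorems

open Summit.CriticalPhenomena.SAWScalingLimit.Theses.SAWRenewalTightness

/-! ### Lattice bookkeeping: consecutive support pairs, the box of sites near a point -/

/-- The (tail, head) pairs of the darts of a walk are the consecutive pairs of its support.
[folklore] -/
private theorem darts_map_eq_support_zip {V : Type*} {G : SimpleGraph V} :
    ∀ {u v : V} (w : G.Walk u v),
      w.darts.map (fun d ↦ (d.fst, d.snd)) = w.support.zip w.support.tail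
  | _, _, .nil => by simp
  | _, _, .cons h w => by
    rw [SimpleGraph.Walk.darts_cons, List.map_cons, SimpleGraph.Walk.support_cons, List.tail_cons,
      darts_map_eq_support_zip w]
    obtain ⟨t, ht⟩ : ∃ t, w.support = _ :: t := ⟨w.support.tail, w.cons_tail_support.symm⟩
    rw [ht]
    rfl

/-- A consecutive pair of the support of a walk is an edge of the graph. [folklore] -/
private theorem adj_of_mem_support_zip {V : Type*} {G : SimpleGraph V} {u v : V} (w : G.Walk u v)
    {p : V × V} (hp : p ∈ w.support.zip w.support.tail) : G.Adj p.1 p.2 := by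
  rw [← darts_map_eq_support_zip] at hp
  obtain ⟨d, -, rfl⟩ := List.mem_map.1 hp
  exact d.adj

/-- A `zip` whose left list has no duplicates has no duplicates. [folklore] -/
private theorem nodup_zip_left {α β : Type*} :
    ∀ {l₁ : List α} {l₂ : List β}, l₁.Nodup → (l₁.zip l₂).Nodup
  | [], _, _ => by simp
  | _ :: _, [], _ => by simp
  | a :: l₁, b :: l₂, h => by
    rw [List.nodup_cons] at h
    rw [List.zip_cons_cons, List.nodup_cons]
    exact ⟨fun hmem ↦ h.1 (List.of_mem_zip hmem).1, nodup_zip_left h.2⟩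

/-- **No self-avoiding walk traverses a shell many times near a controlled set of edges**
(generic-graph form of `Literature.Probability.Percolation.not_hasTraversals_toCurve_of_isPath`):
if every consecutive support pair of the path `w` whose embedded segment meets `B̄(x, ρ)` lies in
the finite set `S`, the polyline of `w` does not traverse `D(x; ρ, R)` `2 (#S + 1) + 1` times.
(AB99 §1.a "short-distance cutoff", quantitative lattice form.)
[cite: AizenmanBurchardDuke1999, §1.a] -/
theorem not_hasTraversals_toCurve_of_isPath_of_subset {V : Type*} [DecidableEq V]
    {G : SimpleGraph V} {u v : V} {w : G.Walk u v} (hw : w.IsPath) (emb : V → ℂ) {x : ℂ}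
    {ρ R : ℝ} (hρR : ρ < R) (S : Finset (V × V))
    (hS : ∀ p ∈ w.support.zip w.support.tail,
      (segment ℝ (emb p.1) (emb p.2) ∩ closedBall x ρ).Nonempty → p ∈ S) :
    ¬ (⟨w.toCurve emb⟩ : Curve ℂ).HasTraversals (2 * (S.card + 1) + 1) x ρ R := by
  classical
  intro htr
  obtain ⟨l, hl⟩ : ∃ l, w.support = u :: l := ⟨w.support.tail, w.cons_tail_support.symm⟩
  have hfun : ∀ t, (⟨w.toCurve emb⟩ : Curve ℂ) t = (polylineFrom (emb u) (l.map emb)).2 t := by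
    intro t
    change polyline (w.support.map emb) t = _
    rw [hl]
    rfl
  have hcov := Literature.Probability.Percolation.hasOrdConnectedCover_preimage_polylineFrom
    (convex_closedBall x ρ) (emb u) (l.map emb)
  have hpre : (⟨w.toCurve emb⟩ : Curve ℂ) ⁻¹' closedBall x ρ =
      (polylineFrom (emb u) (l.map emb)).2 ⁻¹' closedBall x ρ := by
    ext t
    rw [mem_preimage, mem_preimage, hfun]
  rw [← hpre] at hcov
  have hnd : ((u :: l).zip l).Nodup := nodup_zip_left (hl ▸ hw.support_nodup)
  have hcount : Literature.Probability.Percolation.segMeetCount (closedBall x ρ) (emb u)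
      (l.map emb) ≤ S.card := by
    refine Literature.Probability.Percolation.segMeetCount_map_le_card (closedBall x ρ) emb u l
      S hnd fun p hp hmeet ↦ hS p ?_ hmeet
    rw [hl]
    exact hp
  have hle := Literature.Probability.Percolation.le_of_hasTraversals_of_hasOrdConnectedCover
    hρR (hcov.mono (Nat.add_le_add_right hcount 1)) htr
  omega

/-- The `7 × 7` box of sites about `c` has at most `49` elements. [folklore] -/
theorem card_siteBox7_le (c : Site 2) :
    (((Finset.Icc (c 0 - 3) (c 0 + 3)) ×ˢ (Finset.Icc (c 1 - 3) (c 1 + 3))).image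
      (fun q : ℤ × ℤ ↦ (![q.1, q.2] : Site 2))).card ≤ 49 := by
  refine Finset.card_image_le.trans ?_
  have h0 : (c 0 + 3 + 1 - (c 0 - 3)).toNat = 7 := by omega
  have h1 : (c 1 + 3 + 1 - (c 1 - 3)).toNat = 7 := by omega
  rw [Finset.card_product, Int.card_Icc, Int.card_Icc, h0, h1]

/-- Sites coordinatewise within `3` of `c` belong to the `7 × 7` box about `c`. [folklore] -/
theorem mem_siteBox7 {c v : Site 2} (h : ∀ i, |v i - c i| ≤ 3) :
    v ∈ ((Finset.Icc (c 0 - 3) (c 0 + 3)) ×ˢ (Finset.Icc (c 1 - 3) (c 1 + 3))).image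
      (fun q : ℤ × ℤ ↦ (![q.1, q.2] : Site 2)) := by
  rw [Finset.mem_image]
  refine ⟨(v 0, v 1), ?_, ?_⟩
  · have h0 := abs_le.1 (h 0)
    have h1 := abs_le.1 (h 1)
    simp only [Finset.mem_product, Finset.mem_Icc]
    omega
  · ext j
    fin_cases j <;> rfl

/-! ### (H0) for the SAW polyline: the short-distance cutoff -/

/-- **Short-distance cutoff for self-avoiding polylines** (hypothesis (H0) of the criterion):
a self-avoiding walk of `Ω_δ ⊆ δℤ²`, drawn as the polyline through its mesh points, traverses no
shell `D(x; ρ, R)` of inner radius `ρ ≤ δ` (`ρ < R`) by `2 (49² + 1) + 1` separate segments: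
an edge of `δℤ²` meeting `B̄(x, ρ)` has both ends within `ρ + δ ≤ 2δ` of `x`, hence in the
`7 × 7` box of sites about the site nearest to `x`, and a path uses each edge at most once.
(AB99 §1.a: "a SAW uses each of the boundedly many edges near `x` at most once".)
[cite: AizenmanBurchardDuke1999, §1.a] -/
theorem not_hasTraversals_domainSAW {Ω : Set ℂ} {δ : ℝ} (hδ : 0 < δ) {a b : Site 2}
    (γ : SAW.DomainSAW Ω δ a b) {x : ℂ} {ρ R : ℝ} (hρδ : ρ ≤ δ) (hρR : ρ < R) :
    ¬ (⟨γ.walk.toCurve (meshPoint δ)⟩ : Curve ℂ).HasTraversals (2 * (49 * 49 + 1) + 1) x ρ R := by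
  classical
  set c : Site 2 := nearestSite δ x with hc
  set box : Finset (Site 2) :=
    ((Finset.Icc (c 0 - 3) (c 0 + 3)) ×ˢ (Finset.Icc (c 1 - 3) (c 1 + 3))).image
      (fun q : ℤ × ℤ ↦ (![q.1, q.2] : Site 2)) with hbox
  have hcard : (box ×ˢ box).card ≤ 49 * 49 := by
    rw [Finset.card_product]
    exact Nat.mul_le_mul (card_siteBox7_le c) (card_siteBox7_le c)
  intro htr
  refine not_hasTraversals_toCurve_of_isPath_of_subset γ.isPath (meshPoint δ) hρR (box ×ˢ box)
    (fun p hp hmeet ↦ ?_) (htr.of_le (by omega))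
  -- the pair is an edge of `Ω_δ`, hence of `ℤ²`: its mesh points are at distance `δ`
  have hadj : (zdGraph 2).Adj p.1 p.2 :=
    meshGraph_le_zdGraph Ω δ (discreteDomainGraph_le_meshGraph Ω δ (adj_of_mem_support_zip _ hp))
  have hdist : dist (meshPoint δ p.1) (meshPoint δ p.2) = δ := by
    rw [Literature.Probability.Percolation.dist_meshPoint_of_adj hadj, abs_of_pos hδ]
  obtain ⟨z, hzseg, hzball⟩ := hmeet
  rw [mem_closedBall] at hzball
  have hz1 : dist (meshPoint δ p.1) z ≤ δ := by
    have := dist_add_dist_of_mem_segment hzseg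
    linarith [dist_nonneg (x := z) (y := meshPoint δ p.2)]
  have hz2 : dist (meshPoint δ p.2) z ≤ δ := by
    have := dist_add_dist_of_mem_segment hzseg
    rw [dist_comm z] at this
    linarith [dist_nonneg (x := meshPoint δ p.1) (y := z)]
  have h1 : dist (meshPoint δ p.1) x ≤ 2 * δ := by
    linarith [dist_triangle (meshPoint δ p.1) z x]
  have h2 : dist (meshPoint δ p.2) x ≤ 2 * δ := by
    linarith [dist_triangle (meshPoint δ p.2) z x]
  have hn : (2 : ℝ) + 1 ≤ (3 : ℕ) := by norm_num
  have hb1 : p.1 ∈ box := mem_siteBox7 fun i ↦ by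
    have := Literature.Probability.Percolation.abs_sub_nearestSite_le hδ h1 hn i
    rw [← hc] at this
    exact_mod_cast this
  have hb2 : p.2 ∈ box := mem_siteBox7 fun i ↦ by
    have := Literature.Probability.Percolation.abs_sub_nearestSite_le hδ h2 hn i
    rw [← hc] at this
    exact_mod_cast this
  exact Finset.mem_product.2 ⟨hb1, hb2⟩

/-- **The trace of a SAW polyline lies in any disc containing the mesh points of its vertices**
(the polyline is piecewise linear and discs are convex). [folklore] -/
theorem range_toCurve_domainSAW_subset {Ω : Set ℂ} {δ : ℝ} {a b : Site 2}
    (γ : SAW.DomainSAW Ω δ a b) {r : ℝ}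
    (h : ∀ p ∈ γ.walk.support, meshPoint δ p ∈ closedBall (0 : ℂ) r) :
    (⟨γ.walk.toCurve (meshPoint δ)⟩ : Curve ℂ).range ⊆ closedBall 0 r := by
  obtain ⟨l, hl⟩ : ∃ l, γ.walk.support = a :: l :=
    ⟨γ.walk.support.tail, γ.walk.cons_tail_support.symm⟩
  have hfun : ∀ t, (⟨γ.walk.toCurve (meshPoint δ)⟩ : Curve ℂ) t =
      (polylineFrom (meshPoint δ a) (l.map (meshPoint δ))).2 t := by
    intro t
    change polyline (γ.walk.support.map (meshPoint δ)) t = _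
    rw [hl]
    rfl
  rintro _ ⟨t, rfl⟩
  rw [hfun t]
  refine Literature.Probability.Percolation.range_polylineFrom_subset (convex_closedBall 0 r)
    (h a (by simp)) (fun q hq ↦ ?_) ⟨t, rfl⟩
  obtain ⟨p, hp, rfl⟩ := List.mem_map.1 hq
  exact h p (by rw [hl]; exact List.mem_cons_of_mem _ hp)

/-- Every vertex of a walk of `Ω_δ` after the first lies in the discrete domain `Ω_δ`.
[folklore] -/
theorem mem_meshDomain_of_mem_tail_support {Ω : Set ℂ} {δ : ℝ} :
    ∀ {u v : Site 2} (p : (discreteDomainGraph Ω δ).Walk u v),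
      ∀ w ∈ p.support.tail, w ∈ meshDomain Ω δ
  | _, _, .nil => by intro w hw; simp at hw
  | _, _, .cons h q => by
    intro w hw
    rw [SimpleGraph.Walk.support_cons, List.tail_cons, SimpleGraph.Walk.mem_support_iff] at hw
    rcases hw with rfl | hw
    · exact (discreteDomainGraph_adj_iff.1 h).2.2
    · exact mem_meshDomain_of_mem_tail_support q w hw

/-! ### The item -/

/-- **`TightOfShellCrossing`** (route `SAWRenewalTightness`, item stmt-CriticalPhenomena-4732):
the shell-crossing bound (Aizenman–Burchard hypothesis (H1) for the critical `ℤ²` SAW, with a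
shell-dependent threshold) implies eventual tightness of the pushed-forward critical SAW laws,
by the proved criterion `isTightMeasureSet_of_traversalBounds` (AB99 Thms 1.1–1.2) with
`Λ` a large closed disc (`d = 2` covering numbers), `T = (0, δ₀]`, the SAW polyline as the random
curve, threshold `max k k₀` and the short-distance cutoff `not_hasTraversals_domainSAW`.
[cite: AizenmanBurchardDuke1999, Thms 1.1-1.2] -/
theorem TightOfShellCrossing_proof : TightOfShellCrossing := by
  intro hSCB D a b hab
  classical
  -- the data of the shell-crossing bound
  obtain ⟨k, K, lam, δ₁, hlam, hδ₁, hbound⟩ := hSCB D a b hab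
  -- the endpoint `a_δ` is within `1` of the marked point `a` for small `δ`
  have hnear : ∀ᶠ δ in 𝓝[>] (0 : ℝ), meshPoint δ (a δ) ∈ ball (D.pt 0) 1 :=
    hab.tendsto_fst.eventually_mem (ball_mem_nhds _ one_pos)
  obtain ⟨δ₂, hδ₂, hsub₂⟩ := mem_nhdsGT_iff_exists_Ioo_subset.1 hnear
  have hδ₂' : (0 : ℝ) < δ₂ := hδ₂
  -- a disc containing the domain and the unit disc about `a`
  obtain ⟨r, hr⟩ := D.isBounded.subset_closedBall (0 : ℂ)
  set rΛ : ℝ := max r 0 + ‖D.pt 0‖ + 1 with hrΛ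
  have hrΛ0 : 0 ≤ rΛ := by rw [hrΛ]; positivity
  have hΩ : D.carrier ⊆ closedBall (0 : ℂ) rΛ := hr.trans (closedBall_subset_closedBall (by
    rw [hrΛ]; linarith [le_max_left r 0, norm_nonneg (D.pt 0)]))
  have hball : ball (D.pt 0) 1 ⊆ closedBall (0 : ℂ) rΛ := by
    intro z hz
    rw [mem_ball] at hz
    rw [mem_closedBall, dist_zero_right]
    have := norm_le_norm_add_norm_sub' z (D.pt 0)
    rw [← dist_eq_norm] at this
    rw [hrΛ]
    linarith [le_max_right r 0]
  -- the mesh threshold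
  set δ₀ : ℝ := min (min δ₁ (δ₂ / 2)) 1 with hδ₀
  have hδ₀pos : 0 < δ₀ := lt_min (lt_min hδ₁ (half_pos hδ₂')) one_pos
  have hδ₀1 : δ₀ ≤ 1 := min_le_right _ _
  have hδ₀δ₁ : δ₀ ≤ δ₁ := (min_le_left _ _).trans (min_le_left _ _)
  have hδ₀δ₂ : δ₀ < δ₂ := ((min_le_left _ _).trans (min_le_right _ _)).trans_lt (half_lt_self hδ₂')
  refine ⟨δ₀, hδ₀pos, ?_⟩
  -- the criterion
  have hmain := isTightMeasureSet_of_traversalBounds (E := ℂ) (isCompact_closedBall (0 : ℂ) rΛ)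
    (C := 9 * (rΛ + 2) ^ 2) (d := 2) (by norm_num)
    (fun ρ hρ hρ1 ↦ exists_finset_card_le_cover_closedBall hrΛ0 ρ hρ hρ1)
    (Ω := fun δ ↦ SAW.DomainSAW D.carrier δ (a δ) (b δ))
    (fun δ ↦ SAW.law D.carrier δ (a δ) (b δ))
    (fun δ γ ↦ (⟨γ.walk.toCurve (meshPoint δ)⟩ : Curve ℂ))
    (fun x ρ R ↦ max (k x ρ R) (2 * (49 * 49 + 1) + 1)) (K := max K 0) (lam := lam)
    (le_max_right _ _) hlam (T := Set.Ioc 0 δ₀) (fun δ hδ ↦ ⟨hδ.1, hδ.2.trans hδ₀1⟩) ?_ ?_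
  · exact hmain
  · -- (H0): range in `Λ`, and the short-distance cutoff
    intro δ hδ
    have hδpos : 0 < δ := hδ.1
    refine Filter.Eventually.of_forall fun γ ↦ ⟨?_, fun x ρ R _ hρδ hρR ↦ ?_⟩
    · refine range_toCurve_domainSAW_subset γ fun p hp ↦ ?_
      rw [SimpleGraph.Walk.mem_support_iff] at hp
      rcases hp with rfl | hp
      · exact hball (hsub₂ ⟨hδpos, hδ.2.trans_lt hδ₀δ₂⟩)
      · exact hΩ (meshDomain_subset_meshVertices _ _
          (mem_meshDomain_of_mem_tail_support γ.walk p hp))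
    · exact fun h ↦ not_hasTraversals_domainSAW hδpos γ hρδ hρR (h.of_le (le_max_right _ _))
  · -- (H1): the shell-crossing bound, weakened in the threshold and the constant
    intro δ hδ x ρ R hδρ hρR hR1
    have hδ' : δ ∈ Set.Ioc 0 δ₁ := ⟨hδ.1, hδ.2.trans hδ₀δ₁⟩
    have hρ0 : 0 ≤ ρ := hδ.1.le.trans hδρ
    have hR0 : 0 ≤ R := hρ0.trans hρR.le
    calc SAW.law D.carrier δ (a δ) (b δ)
          {γ | (⟨γ.walk.toCurve (meshPoint δ)⟩ : Curve ℂ).HasTraversals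
            (max (k x ρ R) (2 * (49 * 49 + 1) + 1)) x ρ R}
        ≤ SAW.law D.carrier δ (a δ) (b δ)
          {γ | (⟨γ.walk.toCurve (meshPoint δ)⟩ : Curve ℂ).HasTraversals (k x ρ R) x ρ R} :=
          measure_mono fun γ hγ ↦ Curve.HasTraversals.of_le hγ (le_max_left _ _)
      _ ≤ ENNReal.ofReal (K * (ρ / R) ^ lam) := hbound δ hδ' x ρ R hδρ hρR hR1
      _ ≤ ENNReal.ofReal (max K 0 * (ρ / R) ^ lam) :=
          ENNReal.ofReal_le_ofReal (mul_le_mul_of_nonneg_right (le_max_left _ _)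
            (Real.rpow_nonneg (div_nonneg hρ0 hR0) _))

end Summit.CriticalPhenomena.SAWScalingLimit.Theorems
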